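import Literature.AlgebraicGeometry.AbelianSchemes.MFKUniversalLinearRigidification
import Literature.AlgebraicGeometry.AbelianSchemes.RigidifiedTrivialOfOpenCover
import Literature.AlgebraicGeometry.AbelianSchemes.LDeltaCubeLocus
import Literature.AlgebraicGeometry.Modules.SerreTwistOneOfFrameSections
import Literature.AlgebraicGeometry.Modules.SerreTwistModBaseChange
import Literature.AlgebraicGeometry.Modules.ProjectiveFamilyTwistPushforward
import HarnessLib

/-!
# A linearly rigidified triple read through `ι = pr ≫ ι₀` has `pr^*𝒪(1)` normalised `≅ L^Δ(λ)^{⊗3}` — clause (V) of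
# [MumfordFogartyKirwan1994] Prop. 7.3 for a test triple ((H-rep) representability, converse of ★ (R3))

Layer `Literature/AlgebraicGeometry/AbelianSchemes`, namespace `Literature.AlgebraicGeometry.AbelianSchemes.PolarizedAbelianSchemeWithLevel`.
THEOREMS ONLY (no definition, no named fact, no instance, no notation, no `sorry`).  Cell `hodgecm-mathlib` (D-0151), F-DAG row F-6
(H-rep), part R-B2a of the R-B hand `MFKIntrinsicOfLinearRigidification` (B-plan1 (g17) 2026-08-30T10:56:54Z; B-p18 (g19) split 10:55:54Z
«clause (V) = (V-brick) + ★ `RigidifiedLineBundle.nonempty_iso_of_openCover_of_isLocallyNoetherian`»); author B-p17 (g14).  HC_CM is proved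
only modulo the 7 printed citations until rung 0 closes; nothing here is about HC.

SETTING.  A triple `P = (X/T, λ, σ)` (★ `PolarizedAbelianSchemeWithLevel`) over a locally Noetherian `T` with an embedding
`ι : X → 𝐏^m_ℤ` (`m + 1 = #J + 1`) which is a ★ (8α) `IsLinearRigidification` — Zariski-locally on `T` the morphism of a global frame of
`π_*(L^Δ(λ)^{⊗3})` (★ `IsFrameRigidification`, [MumfordFogartyKirwan1994] Def. 7.5) —, a morphism `pr : X → Z₀` to an auxiliary scheme
embedded by `ι₀ : Z₀ → 𝐏^m_ℤ` with `pr ≫ ι₀ = ι` (the shape of the (H-rep) argument: `Z₀ → H₀` the universal family of `Hilb`, `pr` the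
first projection of a cartesian square), `L₀ := 𝒪_{Z₀}(1) = SerreTwist.twistMod ι₀ 𝒪 1` and `Γ₁ = (1, λ) : X → X ×_T X̂` the graph.

* §1 (FRAME level, any `T`) **`nonempty_pullback_twistMod_one_iso_LDelta_tensorPow_of_isFrameRigidification`** — for a frame-rigidified `P`:
  `pr^*L₀ ≅ (Γ₁^*𝒫)^{⊗3}`.  Proof: the rank-one module whose frame sections define `ι` IS `ι^*𝒪(1)` (★ V-brick (V2)
  `SerreTwist.nonempty_iso_twistMod_one_homEquiv_pointOfSections_ofFrameSystem`, [Hartshorne1977] II Thm. 7.1 (a)), and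
  `𝒪_X(1)` for `ι = pr ≫ ι₀` is `pr^*𝒪_{Z₀}(1)` (★ `SerreTwist.isIso_pullbackTwistHom`).
* §2 (LINEAR level, `T` locally Noetherian) **`nonempty_normalised_iso_LDelta_tensorPow_of_isLinearRigidification`** — for a linearly
  rigidified `P`: **`pr^*L₀ ⊗ π^*(ε^*pr^*L₀)^∨ ≅ (Γ₁^*𝒫)^{⊗3}`** (= clause (V) of ★ FILE 3 `mfkIntrinsic_of_existsUnique_comp`'s INT(b) at
  `Lb := pr^*L₀`).  Proof: on each member `uᵢ : Uᵢ → T` of the rigidifying cover, §1 for `P|_{Uᵢ}` at `prᵢ := pr_X ≫ pr` and ★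
  `IsBaseChangeVia.nonempty_iso_pullback_LDelta` (`pr_X^*L^Δ(λ) ≅ L^Δ(λ|_{Uᵢ})`, ★ `baseChange_isBaseChangeVia`) give
  `pr_X^*(pr^*L₀) ≅ pr_X^*(Γ₁^*𝒫)^{⊗3}` on `X ×_T Uᵢ`; in `Ȟ¹(X ×_T Uᵢ, 𝒪^×)` the twist `π^*(ε^*Lb)^∨` then dies (`ε^*[(Γ₁^*𝒫)^{⊗3}] = 1`:
  `ε ≫ Γ₁ = ε̂ ≫ (ε × 1)` and clause (b) of the dual pair), so the two RIGIDIFIED line bundles `Lb′ := Lb ⊗ π^*(ε^*Lb)^∨` (★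
  `cechPic_pullback_unitSection_detClass_normalised`) and `(Γ₁^*𝒫)^{⊗3}` agree on every `X ×_T Uᵢ`; by ★
  `RigidifiedLineBundle.nonempty_iso_of_openCover_of_isLocallyNoetherian` ([MumfordAV1970] §5 Cor. 6 + §13, run on `X ×_T T` along `𝟙 T`)
  they are isomorphic.  Auxiliary: `cechPic_pullback_unitSection_detClass_LDelta_eq_one` (`ε^*[Γ₁^*𝒫] = 1`).

## References
* [MumfordFogartyKirwan1994] D. Mumford, J. Fogarty, F. Kirwan, *Geometric Invariant Theory*, 3rd ed. (1994), Ch. 7 §2 Def. 7.5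
  (p. 130), Prop. 7.3 and its proof, step (V) (pp. 132–134), Prop. 7.6 (p. 136); Ch. 6 §2 Def. 6.2 (p. 120).
* [Hartshorne1977] R. Hartshorne, *Algebraic Geometry* (1977), II Thm. 7.1 (a) (p. 150), II Prop. 5.12 (c), III Ex. 4.5.
* [MumfordAV1970] D. Mumford, *Abelian Varieties* (1970), §5 Cor. 6 (p. 54), §13 (proof of the Thm. p. 125).
-/

noncomputable section

-- Mathlib's `Over`/pull-back API and `Scheme.Modules` section API are stated across semireducible wrappers (as in ★ (R3)).
set_option backward.isDefEq.respectTransparency false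

open CategoryTheory CategoryTheory.Limits AlgebraicGeometry MonoidalCategory
open Literature.AlgebraicGeometry.Modules Literature.AlgebraicGeometry.Modules.SerreTwist
open Literature.AlgebraicGeometry.Motives Literature.AlgebraicGeometry.Motives.GeneratingSections
open Literature.AlgebraicGeometry.Morphisms Literature.AlgebraicGeometry.AbelianVarieties
open scoped MonObj

universe u

namespace Literature.AlgebraicGeometry.AbelianSchemes

namespace PolarizedAbelianSchemeWithLevel

variable {g N : ℕ} {δ : Fin g → ℕ} (J : Type) [Finite J] {Z₀ : Scheme.{0}} (ι₀ : Z₀ ⟶ projectiveSpaceInt J)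

/-! ## §1 Frame level: `pr^*𝒪_{Z₀}(1) ≅ L^Δ(λ)^{⊗3}` for a frame-rigidified triple read through `pr ≫ ι₀` -/

/-- **For a FRAME-rigidified triple `P` (★ `IsFrameRigidification J ι`) and `ι = pr ≫ ι₀`: `pr^*𝒪_{Z₀}(1) ≅ (Γ₁^*𝒫)^{⊗3}`** for
the graph `Γ₁ = (1, λ)` (any `Γ₁` with the two projections; the frame datum's own graph agrees with it by `pullback.hom_ext`).
[Hartshorne1977] II Thm. 7.1 (a) in module currency (★ V-brick (V2): the framed `(Gr^*𝒫)^{⊗3}` IS `ι^*𝒪(1) = twistMod ι 𝒪 1`) and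
`twistMod (pr ≫ ι₀) 𝒪 1 ≅ pr^*(twistMod ι₀ 𝒪 1)` (★ `SerreTwist.isIso_pullbackTwistHom`, [Hartshorne1977] II Prop. 5.12 (c)).
[cite: Hartshorne1977, II Thm. 7.1 (a) (p. 150)] [cite: MumfordFogartyKirwan1994, Ch. 7 §2 Def. 7.5 (p. 130)] -/
theorem nonempty_pullback_twistMod_one_iso_LDelta_tensorPow_of_isFrameRigidification {T : Scheme.{0}}
    (P : PolarizedAbelianSchemeWithLevel g N δ T) {emb : P.A.X.left ⟶ projectiveSpaceInt J} (hP : P.IsFrameRigidification J emb)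
    (pr : P.A.X.left ⟶ Z₀) (hι : pr ≫ ι₀ = emb)
    (Γ₁ : P.A.X.left ⟶ P.A.prodLeft P.D.hat) (hΓ₁₁ : Γ₁ ≫ pullback.fst P.A.X.hom P.D.hat.X.hom = 𝟙 _)
    (hΓ₁₂ : Γ₁ ≫ pullback.snd P.A.X.hom P.D.hat.X.hom = P.pol.lam.left) :
    Nonempty ((Scheme.Modules.pullback pr).obj (twistMod ι₀ (unitModule Z₀) 1) ≅
      tensorPow ((Scheme.Modules.pullback Γ₁).obj P.D.P) 3) := by
  subst hι
  obtain ⟨Gr, hGr₁, hGr₂, F, h1, e, hcov, hEq⟩ := hP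
  have hGG : Gr = Γ₁ := pullback.hom_ext (hGr₁.trans hΓ₁₁.symm) (hGr₂.trans hΓ₁₂.symm)
  subst hGG
  obtain ⟨φ⟩ := nonempty_iso_twistMod_one_homEquiv_pointOfSections_ofFrameSystem (J := J) P.A.X.hom F h1
    (fun j ↦ (basisSection e j :)) hcov
  rw [hEq] at φ
  haveI := isIso_pullbackTwistHom pr ι₀ 1
  exact ⟨asIso (pullbackTwistHom pr ι₀ 1) ≪≫ φ.symm⟩

/-! ## §2 Linear level: clause (V) `Lb′ ≅ L^Δ(λ)^{⊗3}` by gluing rigidified line bundles over the rigidifying cover -/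

/-- **`ε^*[Γ₁^*𝒫] = 1` in `Ȟ¹(T, 𝒪^×)`**: the graph of a HOMOMORPHISM `λ` sends the zero section to `(ε_X, ε_X̂) = ε_X̂ ≫ (ε_X × 1)`
(`IsMonHom.one_hom`), along which `𝒫` is trivial (clause (b) of the dual pair) — `L^Δ(λ) = Γ₁^*𝒫` is rigidified.
[cite: MumfordFogartyKirwan1994, Ch. 6 §2 Definition 6.2 (p. 120)] [cite: Hartshorne1977, III Ex. 4.5] -/
theorem cechPic_pullback_unitSection_detClass_LDelta_eq_one {T : Scheme.{0}} (P : PolarizedAbelianSchemeWithLevel g N δ T)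
    (Γ₁ : P.A.X.left ⟶ P.A.prodLeft P.D.hat) (hΓ₁₁ : Γ₁ ≫ pullback.fst P.A.X.hom P.D.hat.X.hom = 𝟙 _)
    (hΓ₁₂ : Γ₁ ≫ pullback.snd P.A.X.hom P.D.hat.X.hom = P.pol.lam.left)
    (h : IsFiniteLocallyFree ((Scheme.Modules.pullback Γ₁).obj P.D.P)) :
    CechPic.pullback P.A.unitSection (detClass h) = 1 := by
  haveI := P.pol.isMonHom
  have hεΓ : P.A.unitSection ≫ Γ₁ = P.D.hat.unitSection ≫ P.A.unitSlice P.D.hat := by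
    apply pullback.hom_ext
    · rw [Category.assoc, hΓ₁₁, Category.comp_id, Category.assoc, AbelianSchemeOver.unitSlice_fst, ← Category.assoc,
        P.D.hat.unitSection_comp_hom, Category.id_comp]
    · rw [Category.assoc, hΓ₁₂, Category.assoc, AbelianSchemeOver.unitSlice_snd, Category.comp_id]
      change (η[P.A.X]).left ≫ P.pol.lam.left = (η[P.D.hat.X]).left
      rw [← Over.comp_left, IsMonHom.one_hom]
  obtain ⟨r⟩ := P.D.rigid
  rw [(detClass_eq_of_iso (Iso.refl _) h ((HasRank.isFiniteLocallyFree' P.D.hasRank_one).pullback Γ₁)).trans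
      (detClass_pullback Γ₁ (HasRank.isFiniteLocallyFree' P.D.hasRank_one)),
    ← CechPic.pullback_comp, hεΓ, CechPic.pullback_comp,
    ← detClass_pullback (P.A.unitSlice P.D.hat) (HasRank.isFiniteLocallyFree' P.D.hasRank_one),
    detClass_eq_of_iso r ((HasRank.isFiniteLocallyFree' P.D.hasRank_one).pullback _)
      (HasRank.isFiniteLocallyFree' hasRank_unitModule),
    detClass_unitModule_eq_one, map_one]

/-- **CLAUSE (V) FOR A LINEARLY RIGIDIFIED TRIPLE: `Lb ⊗ π^*(ε^*Lb)^∨ ≅ (Γ₁^*𝒫)^{⊗3}` with `Lb := pr^*𝒪_{Z₀}(1)`** — the letter of clause (V)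
of ★ FILE 3's INT(b) ([MumfordFogartyKirwan1994] Prop. 7.3 step (V): «`L′ ≅ L^Δ(ω̄)^3`», `L′` the normalised `𝒪(1)`), for a triple
`P` over a locally Noetherian `T` carrying a ★ (8α) linear rigidification `ι = pr ≫ ι₀`.  On each member `uᵢ` of the rigidifying cover, §1
for `P|_{Uᵢ}` (★ `baseChange`) together with ★ `IsBaseChangeVia.nonempty_iso_pullback_LDelta` give `pr_X^*Lb ≅ pr_X^*(Γ₁^*𝒫)^{⊗3}` on
`X ×_T Uᵢ`; hence also `pr_X^*Lb′ ≅ pr_X^*(Γ₁^*𝒫)^{⊗3}` (the twist `π^*(ε^*Lb)^∨` dies there: `ε^*` of the two sides agree and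
`ε^*[(Γ₁^*𝒫)^{⊗3}] = 1`); both sides are rank one and RIGIDIFIED along `ε` (★ `cechPic_pullback_unitSection_detClass_normalised`,
`cechPic_pullback_unitSection_detClass_LDelta_eq_one`), so ★ `RigidifiedLineBundle.nonempty_iso_of_openCover_of_isLocallyNoetherian` (two
rigidified line bundles on `X_T` isomorphic on every `X_{Uᵢ}` are isomorphic; run on `X ×_T T` along `𝟙 T`) glues the local isomorphisms.
[cite: MumfordFogartyKirwan1994, Ch. 7 §2 Proposition 7.3 (pp. 132–134)] [cite: MumfordFogartyKirwan1994, Ch. 7 §2 Def. 7.5 (p. 130)]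
[cite: MumfordAV1970, §13 (proof of the Thm. p. 125) with §5 Cor. 6 (p. 54)] -/
theorem nonempty_normalised_iso_LDelta_tensorPow_of_isLinearRigidification {T : Scheme.{0}} [IsLocallyNoetherian T]
    (P : PolarizedAbelianSchemeWithLevel g N δ T) {emb : P.A.X.left ⟶ projectiveSpaceInt J} (hP : P.IsLinearRigidification J emb)
    (pr : P.A.X.left ⟶ Z₀) (hι : pr ≫ ι₀ = emb)
    (Γ₁ : P.A.X.left ⟶ P.A.prodLeft P.D.hat) (hΓ₁₁ : Γ₁ ≫ pullback.fst P.A.X.hom P.D.hat.X.hom = 𝟙 _)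
    (hΓ₁₂ : Γ₁ ≫ pullback.snd P.A.X.hom P.D.hat.X.hom = P.pol.lam.left) :
    Nonempty (tensorObj ((Scheme.Modules.pullback pr).obj (twistMod ι₀ (unitModule Z₀) 1))
        ((Scheme.Modules.pullback P.A.X.hom).obj (Modules.dual ((Scheme.Modules.pullback P.A.unitSection).obj
          ((Scheme.Modules.pullback pr).obj (twistMod ι₀ (unitModule Z₀) 1))))) ≅
      tensorPow ((Scheme.Modules.pullback Γ₁).obj P.D.P) 3) := by
  obtain ⟨𝒰, h𝒰⟩ := hP
  -- ranks and local-freeness witnesses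
  have hL₀ : HasRank (twistMod ι₀ (unitModule Z₀) 1) 1 := hasRank_twistMod_unitModule ι₀ 1
  have hLb : HasRank ((Scheme.Modules.pullback pr).obj (twistMod ι₀ (unitModule Z₀) 1)) 1 := hasRank_pullback pr hL₀
  have hLb' := P.A.hasRank_normalised _ hLb
  have hM : HasRank ((Scheme.Modules.pullback Γ₁).obj P.D.P) 1 := hasRank_pullback Γ₁ P.D.hasRank_one
  have hM3 : HasRank (tensorPow ((Scheme.Modules.pullback Γ₁).obj P.D.P) 3) 1 := hasRank_tensorPow_one hM 3
  have hεLb : HasRank ((Scheme.Modules.pullback P.A.unitSection).obj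
      ((Scheme.Modules.pullback pr).obj (twistMod ι₀ (unitModule Z₀) 1))) 1 := hasRank_pullback _ hLb
  have hQd : HasRank (Modules.dual ((Scheme.Modules.pullback P.A.unitSection).obj
      ((Scheme.Modules.pullback pr).obj (twistMod ι₀ (unitModule Z₀) 1)))) 1 := hasRank_dual hεLb
  have hQ : HasRank ((Scheme.Modules.pullback P.A.X.hom).obj (Modules.dual ((Scheme.Modules.pullback P.A.unitSection).obj
      ((Scheme.Modules.pullback pr).obj (twistMod ι₀ (unitModule Z₀) 1))))) 1 := hasRank_pullback _ hQd
  let fLb := HasRank.isFiniteLocallyFree' hLb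
  let fLb' := HasRank.isFiniteLocallyFree' hLb'
  let fM := HasRank.isFiniteLocallyFree' hM
  let fM3 := HasRank.isFiniteLocallyFree' hM3
  let fεLb := HasRank.isFiniteLocallyFree' hεLb
  let fQd := HasRank.isFiniteLocallyFree' hQd
  let fQ := HasRank.isFiniteLocallyFree' hQ
  -- `ε^*[(Γ₁^*𝒫)^{⊗3}] = 1` and `ε^*[Lb′] = 1`
  have hεM3 : CechPic.pullback P.A.unitSection (detClass fM3) = 1 := by
    rw [detClass_tensorPow hM fM 3 fM3, map_pow, P.cechPic_pullback_unitSection_detClass_LDelta_eq_one Γ₁ hΓ₁₁ hΓ₁₂ fM, one_pow]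
  have hεLb' : CechPic.pullback P.A.unitSection (detClass fLb') = 1 :=
    P.A.cechPic_pullback_unitSection_detClass_normalised _ hLb fLb'
  -- the class of `Lb′` in terms of that of `Lb`
  have cLb' : detClass fLb' = detClass fLb *
      (CechPic.pullback P.A.X.hom (CechPic.pullback P.A.unitSection (detClass fLb)))⁻¹ := by
    rw [detClass_tensorObj_of_hasRank_one hLb hQ fLb fQ fLb',
      (detClass_eq_of_iso (Iso.refl _) fQ (fQd.pullback P.A.X.hom)).trans (detClass_pullback P.A.X.hom fQd),
      detClass_dual' fεLb fQd, (detClass_eq_of_iso (Iso.refl _) fεLb (fLb.pullback P.A.unitSection)).trans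
        (detClass_pullback P.A.unitSection fLb), map_inv]
  -- LOCAL agreement of the classes of `Lb′` and `(Γ₁^*𝒫)^{⊗3}` on every `X ×_T Uᵢ`
  have hloc : ∀ i, CechPic.pullback (X := (P.A.baseChange (𝒰.f i)).X.left) (pullback.fst P.A.X.hom (𝒰.f i)) (detClass fLb') =
      CechPic.pullback (X := (P.A.baseChange (𝒰.f i)).X.left) (pullback.fst P.A.X.hom (𝒰.f i)) (detClass fM3) := by
    intro i
    -- the graph of `λ|_{Uᵢ}`
    let Grv : (P.baseChange (𝒰.f i)).A.X.left ⟶ (P.baseChange (𝒰.f i)).A.prodLeft (P.baseChange (𝒰.f i)).D.hat :=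
      pullback.lift (𝟙 _) (P.baseChange (𝒰.f i)).pol.lam.left
        (by rw [Category.id_comp]; exact (Over.w (P.baseChange (𝒰.f i)).pol.lam).symm)
    have hGrv₁ : Grv ≫ pullback.fst (P.baseChange (𝒰.f i)).A.X.hom (P.baseChange (𝒰.f i)).D.hat.X.hom = 𝟙 _ :=
      pullback.lift_fst _ _ _
    have hGrv₂ : Grv ≫ pullback.snd (P.baseChange (𝒰.f i)).A.X.hom (P.baseChange (𝒰.f i)).D.hat.X.hom =
        (P.baseChange (𝒰.f i)).pol.lam.left := pullback.lift_snd _ _ _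
    -- §1 on `P|_{Uᵢ}` at `pr_X ≫ pr`, and `pr_X^*L^Δ(λ) ≅ L^Δ(λ|_{Uᵢ})`
    obtain ⟨κ⟩ := nonempty_pullback_twistMod_one_iso_LDelta_tensorPow_of_isFrameRigidification J ι₀ (P.baseChange (𝒰.f i))
      (h𝒰 i) (pullback.fst P.A.X.hom (𝒰.f i) ≫ pr) (by rw [Category.assoc, hι]) Grv hGrv₁ hGrv₂
    obtain ⟨ψ⟩ := (P.baseChange_isBaseChangeVia (𝒰.f i)).nonempty_iso_pullback_LDelta Γ₁ hΓ₁₁ hΓ₁₂ Grv hGrv₁ hGrv₂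
    obtain ⟨σ⟩ := AbelianSchemeOver.DualPair.nonempty_tensorPow_iso_of_iso ψ 3
    obtain ⟨τ⟩ := nonempty_pullback_tensorPow_iso (M := (Scheme.Modules.pullback Γ₁).obj P.D.P)
      (pullback.fst P.A.X.hom (𝒰.f i)) hM 3
    have iLb : (Scheme.Modules.pullback (pullback.fst P.A.X.hom (𝒰.f i))).obj
          (tensorPow ((Scheme.Modules.pullback Γ₁).obj P.D.P) 3) ≅
        (Scheme.Modules.pullback (pullback.fst P.A.X.hom (𝒰.f i))).obj
          ((Scheme.Modules.pullback pr).obj (twistMod ι₀ (unitModule Z₀) 1)) :=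
      τ ≪≫ σ ≪≫ κ.symm ≪≫ ((Scheme.Modules.pullbackComp (pullback.fst P.A.X.hom (𝒰.f i)) pr).app _).symm
    have c1 : CechPic.pullback (X := (P.A.baseChange (𝒰.f i)).X.left) (pullback.fst P.A.X.hom (𝒰.f i)) (detClass fLb) =
        CechPic.pullback (X := (P.A.baseChange (𝒰.f i)).X.left) (pullback.fst P.A.X.hom (𝒰.f i)) (detClass fM3) := by
      rw [← detClass_pullback (X := (P.A.baseChange (𝒰.f i)).X.left) (pullback.fst P.A.X.hom (𝒰.f i)) fLb,
        ← detClass_pullback (X := (P.A.baseChange (𝒰.f i)).X.left) (pullback.fst P.A.X.hom (𝒰.f i)) fM3]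
      exact (detClass_eq_of_iso iLb _ _).symm
    -- `pr_X ≫ π ≫ ε = π′ ≫ ε′ ≫ pr_X` (`pullback.condition`, ★ `unitSection_baseChange_comp_fst`)
    have hm : ((pullback.fst P.A.X.hom (𝒰.f i) : (P.A.baseChange (𝒰.f i)).X.left ⟶ P.A.X.left) ≫ P.A.X.hom) ≫ P.A.unitSection =
        ((P.A.baseChange (𝒰.f i)).X.hom ≫ (P.A.baseChange (𝒰.f i)).unitSection) ≫
          (pullback.fst P.A.X.hom (𝒰.f i) : (P.A.baseChange (𝒰.f i)).X.left ⟶ P.A.X.left) :=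
      (Category.assoc _ _ _).trans (((congrArg (· ≫ P.A.unitSection) (pullback.condition (f := P.A.X.hom) (g := 𝒰.f i))).trans
        (Category.assoc _ _ _)).trans ((congrArg ((P.A.baseChange (𝒰.f i)).X.hom ≫ ·)
          (P.A.unitSection_baseChange_comp_fst (𝒰.f i))).symm.trans (Category.assoc _ _ _).symm))
    have key : CechPic.pullback (X := (P.A.baseChange (𝒰.f i)).X.left) (pullback.fst P.A.X.hom (𝒰.f i))
        (CechPic.pullback P.A.X.hom (CechPic.pullback P.A.unitSection (detClass fLb))) = 1 :=
      calc CechPic.pullback (X := (P.A.baseChange (𝒰.f i)).X.left) (pullback.fst P.A.X.hom (𝒰.f i))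
            (CechPic.pullback P.A.X.hom (CechPic.pullback P.A.unitSection (detClass fLb)))
          = CechPic.pullback (((pullback.fst P.A.X.hom (𝒰.f i) : (P.A.baseChange (𝒰.f i)).X.left ⟶ P.A.X.left) ≫
              P.A.X.hom) ≫ P.A.unitSection) (detClass fLb) :=
            ((CechPic.pullback_comp (((pullback.fst P.A.X.hom (𝒰.f i) : (P.A.baseChange (𝒰.f i)).X.left ⟶ P.A.X.left)) ≫
              P.A.X.hom) P.A.unitSection _).trans (CechPic.pullback_comp _ P.A.X.hom _)).symm
        _ = CechPic.pullback (((P.A.baseChange (𝒰.f i)).X.hom ≫ (P.A.baseChange (𝒰.f i)).unitSection) ≫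
              (pullback.fst P.A.X.hom (𝒰.f i) : (P.A.baseChange (𝒰.f i)).X.left ⟶ P.A.X.left)) (detClass fLb) :=
            congrArg (CechPic.pullback · (detClass fLb)) hm
        _ = CechPic.pullback ((P.A.baseChange (𝒰.f i)).X.hom ≫ (P.A.baseChange (𝒰.f i)).unitSection)
              (CechPic.pullback (X := (P.A.baseChange (𝒰.f i)).X.left) (pullback.fst P.A.X.hom (𝒰.f i)) (detClass fM3)) := by
            rw [CechPic.pullback_comp, c1]
        _ = CechPic.pullback (((pullback.fst P.A.X.hom (𝒰.f i) : (P.A.baseChange (𝒰.f i)).X.left ⟶ P.A.X.left) ≫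
              P.A.X.hom) ≫ P.A.unitSection) (detClass fM3) := by
            rw [← CechPic.pullback_comp]
            exact congrArg (CechPic.pullback · (detClass fM3)) hm.symm
        _ = 1 := by
            rw [CechPic.pullback_comp, CechPic.pullback_comp, hεM3, map_one, map_one]
    rw [cLb', map_mul, map_inv, key, inv_one, mul_one, c1]
  -- GLUING over `X ×_T T` along `𝟙 T` (★ `RigidifiedLineBundle.nonempty_iso_of_openCover_of_isLocallyNoetherian`)
  let q : (P.A.baseChange (𝟙 T)).X.left ⟶ P.A.X.left := pullback.fst P.A.X.hom (𝟙 T)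
  have hεq : (P.A.baseChange (𝟙 T)).unitSection ≫ q = 𝟙 T ≫ P.A.unitSection := P.A.unitSection_baseChange_comp_fst (𝟙 T)
  have rigid_of : ∀ {X : P.A.X.left.Modules} (hX : HasRank X 1),
      CechPic.pullback P.A.unitSection (detClass (HasRank.isFiniteLocallyFree' hX)) = 1 →
        Nonempty ((Scheme.Modules.pullback (P.A.baseChange (𝟙 T)).unitSection).obj ((Scheme.Modules.pullback q).obj X) ≅
          SheafOfModules.unit _) := by
    intro X hX hεX
    refine (nonempty_iso_iff_detClass_eq (hasRank_pullback _ (hasRank_pullback q hX)) hasRank_unitModule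
      (((HasRank.isFiniteLocallyFree' hX).pullback q).pullback _) (HasRank.isFiniteLocallyFree' hasRank_unitModule)).2 ?_
    rw [detClass_pullback (P.A.baseChange (𝟙 T)).unitSection ((HasRank.isFiniteLocallyFree' hX).pullback q),
      detClass_pullback q (HasRank.isFiniteLocallyFree' hX), ← CechPic.pullback_comp, hεq, CechPic.pullback_comp, hεX, map_one,
      detClass_unitModule_eq_one]
  let M₁ : P.A.RigidifiedLineBundle (𝟙 T) := ⟨(Scheme.Modules.pullback q).obj _, hasRank_pullback q hLb', rigid_of hLb' hεLb'⟩
  let M₂ : P.A.RigidifiedLineBundle (𝟙 T) := ⟨(Scheme.Modules.pullback q).obj _, hasRank_pullback q hM3, rigid_of hM3 hεM3⟩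
  have hglue := AbelianSchemeOver.RigidifiedLineBundle.nonempty_iso_of_openCover_of_isLocallyNoetherian M₁ M₂ 𝒰 fun i ↦ by
    -- the comparison `X ×_T Uᵢ → X ×_T Uᵢ` between the squares over `uᵢ ≫ 𝟙` and `uᵢ`
    let c : (P.A.baseChange (𝒰.f i ≫ 𝟙 T)).X.left ⟶ (P.A.baseChange (𝒰.f i)).X.left :=
      pullback.map P.A.X.hom (𝒰.f i ≫ 𝟙 T) P.A.X.hom (𝒰.f i) (𝟙 _) (𝟙 _) (𝟙 T)
        (by rw [Category.comp_id, Category.id_comp]) (by rw [Category.comp_id, Category.id_comp, Category.comp_id])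
    have hc : P.A.prodMap (𝒰.f i ≫ 𝟙 T) (𝟙 T) (𝒰.f i) rfl ≫ q = c ≫ pullback.fst P.A.X.hom (𝒰.f i) := by
      rw [AbelianSchemeOver.prodMap_fst, pullback.lift_fst]
      exact (Category.comp_id _).symm
    refine (nonempty_iso_iff_detClass_eq (hasRank_pullback _ (hasRank_pullback q hLb')) (hasRank_pullback _ (hasRank_pullback q hM3))
      ((fLb'.pullback q).pullback (P.A.prodMap (𝒰.f i ≫ 𝟙 T) (𝟙 T) (𝒰.f i) rfl))
      ((fM3.pullback q).pullback (P.A.prodMap (𝒰.f i ≫ 𝟙 T) (𝟙 T) (𝒰.f i) rfl))).2 ?_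
    rw [detClass_pullback (P.A.prodMap (𝒰.f i ≫ 𝟙 T) (𝟙 T) (𝒰.f i) rfl) (fLb'.pullback q), detClass_pullback q fLb',
      detClass_pullback (P.A.prodMap (𝒰.f i ≫ 𝟙 T) (𝟙 T) (𝒰.f i) rfl) (fM3.pullback q), detClass_pullback q fM3,
      ← CechPic.pullback_comp, ← CechPic.pullback_comp, hc, CechPic.pullback_comp, CechPic.pullback_comp, hloc i]
  -- back to `X` along the section `(1, π) : X → X ×_T T` of `q`
  obtain ⟨φ⟩ := hglue
  let s : P.A.X.left ⟶ (P.A.baseChange (𝟙 T)).X.left := pullback.lift (𝟙 _) P.A.X.hom (by rw [Category.id_comp, Category.comp_id])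
  have hs : s ≫ q = 𝟙 _ := pullback.lift_fst _ _ _
  exact ⟨((Scheme.Modules.pullbackId _).app _).symm ≪≫ (Scheme.Modules.pullbackCongr hs.symm).app _ ≪≫
    ((Scheme.Modules.pullbackComp s q).app _).symm ≪≫ (Scheme.Modules.pullback s).mapIso φ ≪≫
    (Scheme.Modules.pullbackComp s q).app _ ≪≫ (Scheme.Modules.pullbackCongr hs).app _ ≪≫ (Scheme.Modules.pullbackId _).app _⟩

end PolarizedAbelianSchemeWithLevel

end Literature.AlgebraicGeometry.AbelianSchemes

end
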